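import Literature.Topology.FourManifolds.RegularSublevelMaps
import Literature.Topology.FourManifolds.BoundaryOrientation
import Literature.Topology.FourManifolds.HandlebodyMirrorSymmetry
import Literature.Topology.FourManifolds.RegularDomainMaps
import HarnessLib

/-!
# Opposite orientation characters of two level discs exchanged by an orientation-reversing
# symmetry of the level

Topic `Literature/Topology/FourManifolds` (fact seat
`provefact-Literature.Topology.FourManifolds.IsHandlebody.exists_diffeomorph_isBoundaryGluing_sphere`,
step F2b₁ of the Lickorish–Wallace DAG; orientation bookkeeping of the level-preserving
handle-extension step to which L1 `oneHandle_nonempty_diffeomorph` is reduced in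
`HandleAttachmentNormalisation.lean`: the two feet of a `1`-handle in the level below it have
*opposite* orientation characters, which is what decides — Kosinski, *Differential Manifolds*
(1993), VI (6.6) and the proof of VI (11.4)(c) — how the attaching discs of the two handles are
to be paired before the two-disc theorem `TwoDiscsDiffeotopy.lean` is applied).  Everything here
is **proved**; no named facts.

**The mechanism** (model side; the same as for the mirror symmetry of a handlebody,
`HandlebodyMirrorSymmetry.lean`, `OneHandlebodyMirrorFour.lean`).  Let `P` be a manifold without
boundary, `g : P → ℝ` smooth with a regular level `c` (`RegularSublevel h = {g ≤ c}` with its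
boundary `∂{g ≤ c} = {g = c}`, `RegularLevelSplitting.lean`), and `e : P ≅ P` a diffeomorphism with
`g ∘ e = g` which **reverses** an orientation `oP`.  Then the induced self-diffeomorphism `R` of
`{g ≤ c}` reverses the induced orientation (`mapDiffeomorph_isOrientationReversing`: cancel the
orientation-preserving inclusion), so its boundary restriction `r` reverses the boundary
orientation of the level (`boundaryRestrictDiffeomorph_isOrientationReversing`,
`BoundaryOrientation.lean`).  Consequently, if two smooth maps `Fp, Fm : ℝᵏ → P` with values on
the level are **exchanged by `e`** (`e ∘ Fp = Fm`), their lifts to the level manifold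
(`RegularSublevel.levelFoot`) satisfy `r ∘ F̂p = F̂m`, and **`F̂m` reverses the orientations
`(o₀, ob)` as soon as `F̂p` preserves them** (`levelFoot_isOrientationReversing_of_symm`), `ob`
the boundary orientation; for a connected level the same holds for every orientation of it.
For the model `1`-handle `g = -u₀² + ‖y‖²` on a ball of `ℝⁿ⁺¹`, `e : (u₀, y) ↦ (-u₀, y)` and
the two feet `w ↦ (±√(m + ‖y‖²), y)` this is the statement that the feet of a `1`-handle have
opposite characters (sequel files transport it into a handle chart).

## References

* A. A. Kosinski, *Differential Manifolds* (1993), VI (6.6), proof of VI (11.4)(c). [Kosinski1993]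
* M. W. Hirsch, *Differential Topology*, GTM 33 (1976), Ch. 4 §4, pp. 101–105 (induced and
  boundary orientations; reflections reverse). [HirschDT1976]
* J. Milnor, *Lectures on the h-cobordism theorem* (1965), proof of Thm. 3.13. [MilnorHCobordism1965]
-/

open scoped Manifold ContDiff Topology
open Set Function Module

noncomputable section

namespace Literature.Topology.FourManifolds

universe u

/-- Local notation: `𝔼 n` is the model Euclidean space `EuclideanSpace ℝ (Fin n)`. -/
local notation "𝔼 " n:arg => EuclideanSpace ℝ (Fin n)

namespace RegularSublevel

variable {k : ℕ} {P : Type u} [TopologicalSpace P] [ChartedSpace (𝔼 (k + 1)) P]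
  [IsManifold (𝓡 (k + 1)) ∞ P] {g : P → ℝ} {c : ℝ} (h : IsRegularLevel (𝓡 (k + 1)) g c)

/-! ### An orientation-reversing symmetry of the function reverses the induced orientations -/

section Symmetry

variable (e : P ≃ₘ⟮𝓡 (k + 1), 𝓡 (k + 1)⟯ P) (he : ∀ x, g (e x) = g x)

/-- **The induced self-diffeomorphism of `{g ≤ c}` reverses the induced orientation** if `e`
reverses `oP` (`incl ∘ R = e ∘ incl`, `incl` orientation preserving; cancel it on the left).
Hirsch (1976), Ch. 4 §4. [cite: HirschDT1976, Ch. 4 §4, pp. 101–105] -/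
theorem mapDiffeomorph_isOrientationReversing {oP : SmoothOrientation (𝓡 (k + 1)) P}
    (hrev : e.IsOrientationReversing oP oP) :
    (mapDiffeomorph h h e he).IsOrientationReversing (orientation h oP) (orientation h oP) := by
  have hn : (∞ : WithTop ℕ∞) ≠ 0 := by simp
  set o := orientation h oP with ho
  have hincl : IsOrientationPreserving o oP (incl h) := isOrientationPreserving_incl h oP
  have hR : IsOrientationPreserving oP (-oP) e := hrev
  have hcomp : IsOrientationPreserving o (-oP) (e ∘ incl h) :=
    IsOrientationPreserving.comp_holds hR hincl (e.mdifferentiable hn)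
      ((contMDiff_incl h).mdifferentiable hn) (e.det_mfderiv_ne_zero hn) (det_mfderiv_incl_ne_zero h)
  have heq : (e ∘ incl h : RegularSublevel h → P) = incl h ∘ mapDiffeomorph h h e he := rfl
  rw [heq] at hcomp
  have hincl' : IsOrientationPreserving (-o) (-oP) (incl h) := by
    rw [isOrientationPreserving_neg_neg_iff]; exact hincl
  exact IsOrientationPreserving.of_comp_left hcomp hincl' ((contMDiff_incl h).mdifferentiable hn)
    ((mapDiffeomorph h h e he).mdifferentiable hn) (det_mfderiv_incl_ne_zero h)
    ((mapDiffeomorph h h e he).det_mfderiv_ne_zero hn)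

/-- **The boundary restriction reverses the boundary orientation of the level `{g = c}`.**
Hirsch (1976), Ch. 4 §4, p. 103. [cite: HirschDT1976, Ch. 4 §4, p. 103] -/
theorem boundaryRestrictDiffeomorph_isOrientationReversing {oP : SmoothOrientation (𝓡 (k + 1)) P}
    (hrev : e.IsOrientationReversing oP oP) :
    (boundaryRestrictDiffeomorph h h e he).IsOrientationReversing (orientation h oP).boundary
      (orientation h oP).boundary :=
  Diffeomorph.isOrientationReversing_boundaryMap (mapDiffeomorph h h e he)
    (ρ := boundaryRestrictDiffeomorph h h e he) (fun _ => rfl) (mapDiffeomorph_isOrientationReversing h e he hrev)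

end Symmetry

/-! ### Level discs -/

section Feet

/-- **A map with values on the level, lifted to the level manifold `∂{g ≤ c}`.** [folklore] -/
def levelFoot {N : Type*} (F : N → P) (hF : ∀ w, g (F w) = c) (w : N) :
    ↥((𝓡∂ (k + 1)).boundary (RegularSublevel h)) :=
  ⟨mk h (F w) (hF w).le, (mem_boundary_iff h _).2 (hF w)⟩

/-- The underlying point of the lift. [folklore] -/
@[simp] theorem incl_levelFoot {N : Type*} (F : N → P) (hF : ∀ w, g (F w) = c) (w : N) :
    incl h (levelFoot h F hF w).1 = F w := rfl

/-- **The lift of a smooth map is smooth** (into `{g ≤ c}` by Lee 2013, Cor. 5.30, then into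
its boundary, `BoundaryManifold.contMDiffAt_codRestrict`). [cite: LeeSmoothManifolds2013, Cor. 5.30] -/
theorem contMDiff_levelFoot {E' H' : Type*} [NormedAddCommGroup E'] [NormedSpace ℝ E'] [TopologicalSpace H']
    {J : ModelWithCorners ℝ E' H'} {N : Type*} [TopologicalSpace N] [ChartedSpace H' N]
    {F : N → P} (hFs : ContMDiff J (𝓡 (k + 1)) ∞ F) (hF : ∀ w, g (F w) = c) :
    ContMDiff J (𝓡 k) ∞ (levelFoot h F hF) := by
  intro w
  have h1 : ContMDiffAt J (𝓡∂ (k + 1)) ∞ (fun w => (mk h (F w) (hF w).le : RegularSublevel h)) w := by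
    have := (halfSliceAtlas h).contMDiffAt_codRestrict (fun w => (hF w).le) (hFs w)
    exact this
  exact BoundaryManifold.contMDiffAt_codRestrict (W := RegularSublevel h)
    (g := fun w => (mk h (F w) (hF w).le : RegularSublevel h)) (fun w => (levelFoot h F hF w).2) h1

variable (e : P ≃ₘ⟮𝓡 (k + 1), 𝓡 (k + 1)⟯ P) (he : ∀ x, g (e x) = g x)

include he in
/-- **Discs exchanged by the symmetry have lifts exchanged by its boundary restriction**:
`r ∘ F̂p = F̂m` when `e ∘ Fp = Fm`. [folklore] -/
theorem boundaryRestrictDiffeomorph_levelFoot {N : Type*} {Fp Fm : N → P} (hFp : ∀ w, g (Fp w) = c)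
    (hFm : ∀ w, g (Fm w) = c) (hex : ∀ w, e (Fp w) = Fm w) (w : N) :
    boundaryRestrictDiffeomorph h h e he (levelFoot h Fp hFp w) = levelFoot h Fm hFm w := by
  apply Subtype.ext
  apply injective_incl h
  show e (incl h (levelFoot h Fp hFp w).1) = Fm w
  rw [incl_levelFoot, hex]

include he in
/-- As functions: `r ∘ F̂p = F̂m`. [folklore] -/
theorem boundaryRestrictDiffeomorph_comp_levelFoot {N : Type*} {Fp Fm : N → P} (hFp : ∀ w, g (Fp w) = c)
    (hFm : ∀ w, g (Fm w) = c) (hex : ∀ w, e (Fp w) = Fm w) :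
    (boundaryRestrictDiffeomorph h h e he) ∘ levelFoot h Fp hFp = levelFoot h Fm hFm :=
  funext (boundaryRestrictDiffeomorph_levelFoot h e he hFp hFm hex)

include he in
/-- **Opposite characters of level discs exchanged by an orientation-reversing symmetry.**  Let
`e : P ≅ P` preserve `g` and reverse the orientation `oP`, and let `Fp, Fm : ℝᵏ → P` be smooth
with values on the level `{g = c}`, exchanged by `e`, the lift `F̂p` having everywhere
invertible differential.  If `F̂p` preserves the orientations `(o₀, ob)`, `ob` the boundary
orientation of the level induced by `oP`, then `F̂m = r ∘ F̂p` reverses them.  (For the model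
`1`-handle: the two feet have opposite characters; Kosinski 1993, VI (6.6).)
[cite: Kosinski1993, VI (6.6)] [cite: HirschDT1976, Ch. 4 §4, p. 103] -/
theorem levelFoot_isOrientationReversing_of_symm {oP : SmoothOrientation (𝓡 (k + 1)) P}
    (hrev : e.IsOrientationReversing oP oP) {Fp Fm : 𝔼 k → P}
    (hFps : ContMDiff 𝓘(ℝ, 𝔼 k) (𝓡 (k + 1)) ∞ Fp) (hFp : ∀ w, g (Fp w) = c) (hFm : ∀ w, g (Fm w) = c)
    (hex : ∀ w, e (Fp w) = Fm w)
    (hdet : ∀ w, LinearMap.det (M := 𝔼 k) (mfderiv 𝓘(ℝ, 𝔼 k) (𝓡 k) (levelFoot h Fp hFp) w).toLinearMap ≠ 0)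
    {o₀ : Orientation ℝ (𝔼 k) (Fin (finrank ℝ (𝔼 k)))}
    (hpos : IsOrientationPreserving (SmoothOrientation.modelSpace o₀) (orientation h oP).boundary (levelFoot h Fp hFp)) :
    IsOrientationReversing (SmoothOrientation.modelSpace o₀) (orientation h oP).boundary (levelFoot h Fm hFm) := by
  have hn : (∞ : WithTop ℕ∞) ≠ 0 := by simp
  set r := boundaryRestrictDiffeomorph h h e he with hr
  have hrrev : IsOrientationPreserving (orientation h oP).boundary (-(orientation h oP).boundary) r :=
    boundaryRestrictDiffeomorph_isOrientationReversing h e he hrev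
  have hcomp : IsOrientationPreserving (SmoothOrientation.modelSpace o₀) (-(orientation h oP).boundary)
      (r ∘ levelFoot h Fp hFp) :=
    IsOrientationPreserving.comp_holds hrrev hpos (r.mdifferentiable hn)
      ((contMDiff_levelFoot h hFps hFp).mdifferentiable hn) (r.det_mfderiv_ne_zero hn) hdet
  rw [hr, boundaryRestrictDiffeomorph_comp_levelFoot h e he hFp hFm hex] at hcomp
  exact hcomp

include he in
/-- The converse direction: if `e` is an involution on the feet (`e ∘ Fm = Fp` as well) and
`F̂m` has invertible differential, then `F̂p` reverses `(o₀, ob)` as soon as `F̂m` preserves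
them. [cite: Kosinski1993, VI (6.6)] -/
theorem levelFoot_isOrientationReversing_of_symm' {oP : SmoothOrientation (𝓡 (k + 1)) P}
    (hrev : e.IsOrientationReversing oP oP) {Fp Fm : 𝔼 k → P}
    (hFms : ContMDiff 𝓘(ℝ, 𝔼 k) (𝓡 (k + 1)) ∞ Fm) (hFp : ∀ w, g (Fp w) = c) (hFm : ∀ w, g (Fm w) = c)
    (hex' : ∀ w, e (Fm w) = Fp w)
    (hdet : ∀ w, LinearMap.det (M := 𝔼 k) (mfderiv 𝓘(ℝ, 𝔼 k) (𝓡 k) (levelFoot h Fm hFm) w).toLinearMap ≠ 0)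
    {o₀ : Orientation ℝ (𝔼 k) (Fin (finrank ℝ (𝔼 k)))}
    (hneg : IsOrientationPreserving (SmoothOrientation.modelSpace o₀) (orientation h oP).boundary (levelFoot h Fm hFm)) :
    IsOrientationReversing (SmoothOrientation.modelSpace o₀) (orientation h oP).boundary (levelFoot h Fp hFp) :=
  levelFoot_isOrientationReversing_of_symm h e he hrev hFms hFm hFp hex' hdet hneg

include he in
/-- **Opposite characters, as an equivalence**, when `e` exchanges the two discs in both
directions and both lifts have invertible differentials: `F̂p` preserves `(o₀, ob)` iff `F̂m`
preserves `(-o₀, ob)`. [cite: Kosinski1993, VI (6.6)] -/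
theorem levelFoot_isOrientationPreserving_iff_of_symm {oP : SmoothOrientation (𝓡 (k + 1)) P}
    (hrev : e.IsOrientationReversing oP oP) {Fp Fm : 𝔼 k → P}
    (hFps : ContMDiff 𝓘(ℝ, 𝔼 k) (𝓡 (k + 1)) ∞ Fp) (hFms : ContMDiff 𝓘(ℝ, 𝔼 k) (𝓡 (k + 1)) ∞ Fm)
    (hFp : ∀ w, g (Fp w) = c) (hFm : ∀ w, g (Fm w) = c)
    (hex : ∀ w, e (Fp w) = Fm w) (hex' : ∀ w, e (Fm w) = Fp w)
    (hdetp : ∀ w, LinearMap.det (M := 𝔼 k) (mfderiv 𝓘(ℝ, 𝔼 k) (𝓡 k) (levelFoot h Fp hFp) w).toLinearMap ≠ 0)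
    (hdetm : ∀ w, LinearMap.det (M := 𝔼 k) (mfderiv 𝓘(ℝ, 𝔼 k) (𝓡 k) (levelFoot h Fm hFm) w).toLinearMap ≠ 0)
    (o₀ : Orientation ℝ (𝔼 k) (Fin (finrank ℝ (𝔼 k)))) :
    IsOrientationPreserving (SmoothOrientation.modelSpace o₀) (orientation h oP).boundary (levelFoot h Fp hFp) ↔
      IsOrientationPreserving (SmoothOrientation.modelSpace (-o₀)) (orientation h oP).boundary (levelFoot h Fm hFm) := by
  constructor
  · intro hpos
    have := levelFoot_isOrientationReversing_of_symm h e he hrev hFps hFp hFm hex hdetp hpos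
    rwa [isOrientationReversing_iff_neg, SmoothOrientation.neg_modelSpace] at this
  · intro hneg
    have := levelFoot_isOrientationReversing_of_symm' h e he hrev hFms hFp hFm hex' hdetm hneg
    have h2 : IsOrientationPreserving (SmoothOrientation.modelSpace (-o₀)) (-(orientation h oP).boundary)
        (levelFoot h Fp hFp) := this
    rw [← SmoothOrientation.neg_modelSpace, isOrientationPreserving_neg_neg_iff] at h2
    exact h2

end Feet

end RegularSublevel

end Literature.Topology.FourManifolds

end
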